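import Summits.Schanuel.Schanuel.Theorems.DiophantineDichotomyApproximationPropertyZeroDimDictionary
import HarnessLib

/-!
# Interpolation on a plane complete intersection: `stub_ciInterpolation` (stmt-Schanuel-6117)

Crux `stmt-Schanuel-6117` (`Summit.Schanuel.Schanuel.Theses.DiophantineDichotomy.ApproximationProperty`),
route `DiophantineDichotomy`, line `orbit-interpolation-determinant`, registered stub E
(`stub_ciInterpolation`) of the checked skeleton.

A homogeneous prime `𝔮 ⊂ ℚ[x₀, x₁, x₂]` of rank `1` (a Galois orbit of points of `ℙ²`) whose zeros
lie on the complete intersection `V(Q) ∩ V(R)` of type `(a, b)` imposes independent conditions on the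
forms of every degree `s ≥ a + b`: `dim ℚ[x̲]_s = dim 𝔮_s + deg 𝔮`, GIVEN (hypothesis, stub D of the
skeleton) a linear form `L ∉ 𝔮` with `ℚ[x̲]_{s+N} = L^N ℚ[x̲]_s + (Q, R)_{s+N}` for `s ≥ a + b`.

Proof (the dictionary's `exists_poly_of_interpolation` run backwards). Let `b̄'` be a normalised zero
of `𝔮` (`b'_j = 1`), `K = ℚ(b̄')` (a number field with `[K:ℚ] = deg 𝔮`, landed dictionary) and
`V_n ⊆ K` the values at `b̄` of the forms of degree `n`. Then `V_n ⊆ V_{n+N}` (multiply by `x_j^N`),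
`V_{s+N} ⊆ L(b̄)^N V_s` (the decomposition, `Q(b̄) = R(b̄) = 0`), so `V_s = V_{s+N}` by dimensions;
every element of `K` is a polynomial in `b̄'` (algebraic coordinates), hence — homogenising with
`x_j` — lies in some `V_{s+N} = V_s`: the evaluation map `ℚ[x̲]_s → K` is onto, its kernel is `𝔮_s`
(`mem_iff_aeval_eq_zero`), and rank–nullity gives the clause.

* `CIInterpolation.map_le_map_add`, `CIInterpolation.map_add_le`, `CIInterpolation.exists_mem_map`,
  `CIInterpolation.finrank_eq` — the steps above, for any `m`;
* `stub_ciInterpolation` — the registered statement (`m = 2`).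

Sources: Nesterenko, LNM 1752 Ch. 3 §5 (p. 42); Philippon 1986 §1 (criteria for algebraic
independence, interpolation step).
-/

set_option linter.dupNamespace false

noncomputable section

namespace Summit.Schanuel.Schanuel.Cruxes.ApproximationProperty.OrbitInterpolationDeterminant

open Literature.NumberTheory.Transcendental.Nesterenko MvPolynomial Module
open scoped BigOperators

attribute [local instance] MvPolynomial.gradedAlgebra

namespace CIInterpolation

variable {m : ℕ} {𝔭 : Ideal (Rx m)}

/-- The values of the forms of degree `n` at a point `b̄` with `b_j = 1` are values of forms of degree
`n + N` (multiply by `x_j^N`). [folklore] -/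
theorem map_le_map_add {K : Type*} [CommRing K] [Algebra ℚ K] {b : Fin (m + 1) → K}
    {j : Fin (m + 1)} (hbj : b j = 1) (n N : ℕ) :
    (homogeneousSubmodule (Fin (m + 1)) ℚ n).map (aeval b).toLinearMap ≤
      (homogeneousSubmodule (Fin (m + 1)) ℚ (n + N)).map (aeval b).toLinearMap := by
  rintro z ⟨G, hG, rfl⟩
  refine ⟨G * X j ^ N, (mem_homogeneousSubmodule _ _).mpr
    (((mem_homogeneousSubmodule _ _).mp hG).mul (isHomogeneous_X_pow _ _)), ?_⟩
  simp only [AlgHom.toLinearMap_apply, map_mul, map_pow, aeval_X, hbj, one_pow, mul_one]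

/-- If every form `F` of degree `s + N` is `L^N G` plus an element of an ideal `J` vanishing at `b̄`,
`G` a form of degree `s`, then the values at `b̄` of the forms of degree `s + N` lie in `L(b̄)^N V_s`,
`V_s` the values of the forms of degree `s`. [folklore] -/
theorem map_add_le {K : Type*} [CommRing K] [Algebra ℚ K] {b : Fin (m + 1) → K}
    {J : Ideal (Rx m)} (hJ : ∀ P ∈ J, aeval b P = 0) {L : Rx m} {s N : ℕ}
    (hdec : ∀ F : Rx m, F.IsHomogeneous (s + N) →
      ∃ G : Rx m, G.IsHomogeneous s ∧ F - L ^ N * G ∈ J) :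
    (homogeneousSubmodule (Fin (m + 1)) ℚ (s + N)).map (aeval b).toLinearMap ≤
      ((homogeneousSubmodule (Fin (m + 1)) ℚ s).map (aeval b).toLinearMap).map
        (LinearMap.mulLeft ℚ (aeval b L ^ N)) := by
  rintro z ⟨F, hF, rfl⟩
  obtain ⟨G, hG, hFG⟩ := hdec F ((mem_homogeneousSubmodule _ _).mp hF)
  refine ⟨aeval b G, ⟨G, (mem_homogeneousSubmodule _ _).mpr hG, rfl⟩, ?_⟩
  have h0 := hJ _ hFG
  rw [map_sub, map_mul, map_pow, sub_eq_zero] at h0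
  rw [LinearMap.mulLeft_apply, AlgHom.toLinearMap_apply, h0]

/-- Every element of the field `ℚ(b̄')` of a normalised zero `b̄'` (`b'_j = 1`, algebraic
coordinates) is the value at `b̄` of a form of any large degree: write it as a polynomial in `b̄'` and
homogenise with `x_j`. [folklore] -/
theorem exists_mem_map (h𝔭 : 𝔭.IsPrime)
    (hhom : 𝔭.IsHomogeneous (homogeneousSubmodule (Fin (m + 1)) ℚ)) (hunm : IsUnmixedOfRank 𝔭 1)
    {b' : Fin (m + 1) → ℂ} (hb' : b' ∈ projZeros 𝔭) {j : Fin (m + 1)} (hj : b' j = 1)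
    {b : Fin (m + 1) → ↥(IntermediateField.adjoin ℚ (Set.range b'))} (hb : ∀ k, (b k : ℂ) = b' k)
    (s : ℕ) (z : ↥(IntermediateField.adjoin ℚ (Set.range b'))) :
    ∃ N : ℕ, z ∈ (homogeneousSubmodule (Fin (m + 1)) ℚ (s + N)).map (aeval b).toLinearMap := by
  classical
  have hbj : b j = 1 := Subtype.ext (by rw [hb, hj]; rfl)
  have halg : ∀ x ∈ Set.range b', IsAlgebraic ℚ x := by
    rintro _ ⟨k, rfl⟩
    exact (isIntegral_of_mem_projZeros h𝔭 hhom hunm hb' hj k).isAlgebraic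
  have hz : (z : ℂ) ∈ (aeval (R := ℚ) b').range := by
    rw [← Algebra.adjoin_range_eq_range_aeval,
      ← IntermediateField.adjoin_toSubalgebra_of_isAlgebraic halg]
    exact z.2
  obtain ⟨g, hg⟩ := hz
  refine ⟨g.totalDegree, ∑ k ∈ Finset.range (g.totalDegree + 1),
    homogeneousComponent k g * X j ^ (s + g.totalDegree - k), ?_, ?_⟩
  · refine Submodule.sum_mem _ fun k hk => ?_
    have hk' : k ≤ s + g.totalDegree := by
      have := Finset.mem_range.mp hk
      omega
    have h := (homogeneousComponent_isHomogeneous k g).mul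
      (isHomogeneous_X_pow (R := ℚ) j (s + g.totalDegree - k))
    rw [Nat.add_sub_cancel' hk'] at h
    exact (mem_homogeneousSubmodule _ _).mpr h
  · rw [AlgHom.toLinearMap_apply, map_sum]
    simp only [map_mul, map_pow, aeval_X, hbj, one_pow, mul_one]
    rw [← map_sum, sum_homogeneousComponent]
    exact Subtype.ext ((coe_aeval_eq hb g).trans hg)

/-- **Interpolation from a decomposition.** Let `𝔭` be a homogeneous prime of rank `1` with
normalised zero `b̄'` (`b'_j = 1`), `K = ℚ(b̄')`, `J` an ideal vanishing at `b̄`, `L` a form, and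
suppose every form of degree `s + N` is `L^N G + (J)_{s+N}` with `G` a form of degree `s` (this
forces `L(b̄) ≠ 0`). Then the zeros of `𝔭` impose independent conditions on the forms of degree `s`:
`dim ℚ[x̲]_s = dim 𝔭_s + deg 𝔭` (the evaluation map `ℚ[x̲]_s → K` is onto with kernel `𝔭_s`, and
`[K:ℚ] = deg 𝔭`). [cite: NesterenkoPhilippon2001, Ch. 3 §5 (p. 42); Philippon1986Criteres, §1] -/
theorem finrank_eq (h𝔭 : 𝔭.IsPrime)
    (hhom : 𝔭.IsHomogeneous (homogeneousSubmodule (Fin (m + 1)) ℚ)) (hunm : IsUnmixedOfRank 𝔭 1)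
    {b' : Fin (m + 1) → ℂ} (hb' : b' ∈ projZeros 𝔭) {j : Fin (m + 1)} (hj : b' j = 1)
    [NumberField ↥(IntermediateField.adjoin ℚ (Set.range b'))]
    {b : Fin (m + 1) → ↥(IntermediateField.adjoin ℚ (Set.range b'))} (hb : ∀ k, (b k : ℂ) = b' k)
    {J : Ideal (Rx m)} (hJ : ∀ P ∈ J, aeval b P = 0) {L : Rx m} {s : ℕ}
    (hdec : ∀ (N : ℕ) (F : Rx m), F.IsHomogeneous (s + N) →
      ∃ G : Rx m, G.IsHomogeneous s ∧ F - L ^ N * G ∈ J) :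
    Module.finrank ℚ ↥(homogeneousSubmodule (Fin (m + 1)) ℚ s) =
      Module.finrank ℚ ↥(homogeneousSubmodule (Fin (m + 1)) ℚ s ⊓ 𝔭.restrictScalars ℚ) +
        ideg 𝔭 1 := by
  classical
  have hbj : b j = 1 := Subtype.ext (by rw [hb, hj]; rfl)
  haveI : ∀ n, FiniteDimensional ℚ ↥(homogeneousSubmodule (Fin (m + 1)) ℚ n) := fun n =>
    Module.Finite.iff_fg.mpr (homogeneousSubmodule_fg _ _ n)
  -- `V_s = V_{s+N}`
  have heq : ∀ N : ℕ, (homogeneousSubmodule (Fin (m + 1)) ℚ s).map (aeval b).toLinearMap =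
      (homogeneousSubmodule (Fin (m + 1)) ℚ (s + N)).map (aeval b).toLinearMap := fun N =>
    Submodule.eq_of_le_of_finrank_eq (map_le_map_add hbj s N)
      (le_antisymm (Submodule.finrank_mono (map_le_map_add hbj s N))
        ((Submodule.finrank_mono (map_add_le hJ (hdec N))).trans (Submodule.finrank_map_le _ _)))
  -- `V_s = K`
  have htop : (homogeneousSubmodule (Fin (m + 1)) ℚ s).map (aeval b).toLinearMap = ⊤ := by
    refine Submodule.eq_top_iff'.mpr fun z => ?_
    obtain ⟨N, hN⟩ := exists_mem_map h𝔭 hhom hunm hb' hj hb s z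
    rw [heq N]
    exact hN
  -- rank–nullity for the evaluation map `ℚ[x̲]_s → K`, whose kernel is `𝔭_s`
  set W : Submodule ℚ (Rx m) := homogeneousSubmodule (Fin (m + 1)) ℚ s with hW
  set ev : ↥W →ₗ[ℚ] ↥(IntermediateField.adjoin ℚ (Set.range b')) :=
    (aeval b).toLinearMap.comp W.subtype with hev
  have hkerW : LinearMap.ker ev = Submodule.comap W.subtype (W ⊓ 𝔭.restrictScalars ℚ) := by
    ext ⟨G, hG⟩
    have hG' : G.IsHomogeneous s := (mem_homogeneousSubmodule s G).mp hG
    simp only [LinearMap.mem_ker, hev, LinearMap.comp_apply, Submodule.subtype_apply,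
      AlgHom.toLinearMap_apply, Submodule.mem_comap, Submodule.mem_inf, hG, true_and,
      Submodule.restrictScalars_mem]
    exact (mem_iff_aeval_eq_zero h𝔭 hhom hunm hb' hj hb hG').symm
  have hfr : Module.finrank ℚ ↥(LinearMap.ker ev) =
      Module.finrank ℚ ↥(W ⊓ 𝔭.restrictScalars ℚ) := by
    rw [hkerW]
    exact LinearEquiv.finrank_eq (Submodule.comapSubtypeEquivOfLe inf_le_left)
  have hrange : LinearMap.range ev = ⊤ := by
    rw [hev, LinearMap.range_comp, Submodule.range_subtype]
    exact htop
  have hrn := LinearMap.finrank_range_add_finrank_ker ev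
  rw [hrange, finrank_top, finrank_eq_ideg h𝔭 hhom hunm hb' hj hb, hfr] at hrn
  exact hrn.symm.trans (add_comm _ _)

end CIInterpolation

/-- **Stub E — interpolation on the plane complete intersection** (crux `stmt-Schanuel-6117`, line
`orbit-interpolation-determinant`). Given the decomposition of stub D (for every ideal missing a linear
form, a linear `L ∉ 𝔮` with `ℚ[x̲]_{s+N} = L^N ℚ[x̲]_s + (Q, R)_{s+N}` for `s ≥ a + b`), every
homogeneous prime `𝔮 ⊂ ℚ[x₀, x₁, x₂]` of rank `1` whose zeros lie on `V(Q) ∩ V(R)` (`Q`, `R` forms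
of degrees `a, b ≥ 1`, `(Q)` prime, `R ∉ (Q)`) imposes independent conditions on the forms of degree
`s ≥ a + b`: `dim ℚ[x̲]_s = dim 𝔮_s + deg 𝔮`.
[cite: NesterenkoPhilippon2001, Ch. 3 §5 (p. 42); Philippon1986Criteres, §1] -/
theorem stub_ciInterpolation :
    (∀ (Q R : Rx 2) (a b : ℕ), Q ≠ 0 → Q.IsHomogeneous a → R.IsHomogeneous b → 1 ≤ a → 1 ≤ b →
      (Ideal.span {Q}).IsPrime → R ∉ Ideal.span {Q} →
      ∀ 𝔮 : Ideal (Rx 2), (∃ L : Rx 2, L.IsHomogeneous 1 ∧ L ∉ 𝔮) →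
      ∃ L : Rx 2, L.IsHomogeneous 1 ∧ L ∉ 𝔮 ∧
        ∀ (s N : ℕ) (F : Rx 2), a + b ≤ s → F.IsHomogeneous (s + N) →
          ∃ G : Rx 2, G.IsHomogeneous s ∧ F - L ^ N * G ∈ Ideal.span {Q} ⊔ Ideal.span {R}) →
    ∀ (Q R : Rx 2) (a b : ℕ), Q ≠ 0 → Q.IsHomogeneous a → R.IsHomogeneous b → 1 ≤ a → 1 ≤ b →
      (Ideal.span {Q}).IsPrime → R ∉ Ideal.span {Q} →
      ∀ 𝔮 : Ideal (Rx 2), 𝔮.IsPrime → 𝔮.IsHomogeneous (homogeneousSubmodule (Fin (2 + 1)) ℚ) →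
        IsUnmixedOfRank 𝔮 1 → projZeros 𝔮 ⊆ projZeros (Ideal.span {Q} ⊔ Ideal.span {R}) →
        ∀ s : ℕ, a + b ≤ s →
          Module.finrank ℚ ↥(homogeneousSubmodule (Fin (2 + 1)) ℚ s) =
            Module.finrank ℚ ↥(homogeneousSubmodule (Fin (2 + 1)) ℚ s ⊓ 𝔮.restrictScalars ℚ) +
              ideg 𝔮 1 := by
  intro hD Q R a b hQ0 hQa hRb ha hb hQp hRQ 𝔮 h𝔮 hhom hunm hsub s hs
  classical
  -- a normalised zero `b̄'` of `𝔮`, `b'_j = 1`, and its field `K = ℚ(b̄')`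
  obtain ⟨β₀, hβ₀⟩ := projZeros_nonempty' h𝔮 hhom hunm
  obtain ⟨j, hj0⟩ := Function.ne_iff.mp hβ₀.1
  have hb' : (β₀ j)⁻¹ • β₀ ∈ projZeros 𝔮 :=
    Literature.NumberTheory.Transcendental.PhilipponMain.smul_mem_projZeros
      (fun P hP k => homogeneousComponent_mem_of_mem hhom hP k) hβ₀ (inv_ne_zero hj0)
  have hj : ((β₀ j)⁻¹ • β₀) j = 1 := by
    rw [Pi.smul_apply, smul_eq_mul, inv_mul_cancel₀ hj0]
  haveI := numberField_adjoin h𝔮 hhom hunm hb' hj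
  let bK : Fin (2 + 1) → ↥(IntermediateField.adjoin ℚ (Set.range ((β₀ j)⁻¹ • β₀))) := fun k =>
    ⟨((β₀ j)⁻¹ • β₀) k, IntermediateField.subset_adjoin ℚ _ ⟨k, rfl⟩⟩
  have hbK : ∀ k, (bK k : ℂ) = ((β₀ j)⁻¹ • β₀) k := fun k => rfl
  -- `(Q, R)` vanishes at `b̄`
  have hJ : ∀ P ∈ Ideal.span {Q} ⊔ Ideal.span {R}, aeval bK P = 0 := fun P hP =>
    Subtype.ext (by rw [coe_aeval_eq hbK, (hsub hb').2 P hP]; rfl)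
  -- `x_j ∉ 𝔮`, so stub D applies to `𝔮`
  have hXj : (X j : Rx 2) ∉ 𝔮 := by
    intro h
    have h1 := hb'.2 _ h
    rw [aeval_X, hj] at h1
    exact one_ne_zero h1
  obtain ⟨L, -, -, hdec⟩ :=
    hD Q R a b hQ0 hQa hRb ha hb hQp hRQ 𝔮 ⟨X j, isHomogeneous_X _ _, hXj⟩
  exact CIInterpolation.finrank_eq h𝔮 hhom hunm hb' hj hbK hJ fun N F hF => hdec s N F hs hF

end Summit.Schanuel.Schanuel.Cruxes.ApproximationProperty.OrbitInterpolationDeterminant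

end
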